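import Summits.SmoothPoincare4.SmoothPoincare4.Theorems.CylinderEntropyCylinderRungTwoKillingFluxDefs
import Literature.Geometry.Riemannian.SphericalCylinderEntropy
import HarnessLib

/-!
# Route `CylinderEntropy`, crux `CylinderRungTwo` (stmt-SmoothPoincare4-7631), line `killing-flux`:
# `Relaxation` from Hamilton monotonicity and area-to-floor (registered stub `stub_relaxationOfAreaToFloor`)

Lead reshape r6 of the checked skeleton `Cruxes/CylinderRungTwo/Lines/killing_flux.lean` (lead C,
prover-line-stmt-SmoothPoincare4-7631-c1-0).  The immortal half of the line needs RELAXATION: along an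
immortal smooth cylinder flow `IsCylinderMCF M F ν T` of a compact connected cross-section of
`N = S⁴ × ℝ ⊂ ℝ⁶` with separating, `2`-thin time slices, the typed cylinder entropy `λ_cyl(M_s)` is
eventually below every `1 + ε`.  This file proves the registered implication

  `stub_relaxationOfAreaToFloor : HamiltonMonotonicity → AreaToFloor → Relaxation`

(all three spelled out over the landed vocabulary `…KillingFluxDefs.lean` and the tree's
`SphericalCylinderEntropy.{cylDensity, cylEntropy}`), reducing the relaxation statement to the single GMT
core `AreaToFloor` ("some time slice has area `≤ (1+ε) μH⁴(S⁴)`", registered stub `stub_areaToFloor`) and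
to Hamilton's monotonicity in `N` (registered stub `stub_hamiltonMonotonicity`, LANDED in
`…HamiltonMonotonicity.lean`).  The mechanism is a SOFT LARGE-SCALE LEMMA:

* `zonal_le_one_add_tail`, `cylKernel_le_one_add_tail`, `cylDensity_le_one_add_tail_mul` — for `τ ≥ 1`
  the typed kernel is pointwise `≤ 1 + t(τ)` on `N`, `t(τ) = e^{-τ}/(1 - e^{-τ})` the geometric tail of the
  tree's `abs_term_le` (upper companion of the tree's `one_sub_tail_le_zonal`), hence
  `F̂_{p,τ}(A) ≤ (1 + t(τ)) μH⁴(A)/μH⁴(S⁴)` for `A ⊆ N`;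
* Hamilton's monotonicity with lag `σ = s - t₁` moves every density of `M_s` (any centre, ANY scale
  `τ > 0`) to a density of `M_{t₁}` at scale `τ + σ ≥ σ`, so
  `λ_cyl(M_s) ≤ (1 + t(s - t₁)) · μH⁴(M_{t₁})/μH⁴(S⁴)` for all `s ≥ t₁ + 1`;
* with `δ = min(ε,1)/3`, a time `t₁` where `μH⁴(M_{t₁}) ≤ (1+δ) μH⁴(S⁴)` (area-to-floor) and a lag with
  `t(σ₀) < δ` give `λ_cyl(M_s) ≤ (1+δ)² < 1 + ε` for `s ≥ t₁ + σ₀`.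

No Allard regularity, no equicontinuity of the kernels, no `τ ≥ 1` bookkeeping and no use of
`SliceCalibration` are needed (contrast the r3 cut `AreaDissipation → SlabConfinement →
LargeScaleRelaxation`).  Conversely `Relaxation ⇒ AreaToFloor` by the tree's `measure_ratio_le_cylEntropy`,
so the cut loses nothing.  Everything here is PROVED (no `sorry`, no new definitions, no named facts).

References: R. S. Hamilton, *Monotonicity formulas for parabolic flows on manifolds*, Comm. Anal. Geom. 1
(1993) 127–137 (the monotone quantity); the kernel bounds are elementary (NIST DLMF §18.5.10 majorants as in
the tree file).
-/

noncomputable section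

-- the prescribed namespace `Summit.SmoothPoincare4.SmoothPoincare4.…` repeats `SmoothPoincare4`
set_option linter.dupNamespace false

open MeasureTheory Set
open scoped Manifold ContDiff ENNReal Topology BigOperators

namespace Summit.SmoothPoincare4.SmoothPoincare4.Cruxes.CylinderRungTwo.KillingFlux

open Literature.Geometry.Riemannian
open Literature.Geometry.Riemannian.SphericalCylinderEntropy

/-- Upper companion of the tree's `one_sub_tail_le_zonal`: for `τ ≥ 1` and `|s| ≤ 1`,
`𝔥(τ, s) ≤ 1 + t(τ)` — the `k = 0` mode is `1`, the rest is dominated by the geometric series of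
`abs_term_le`. [folklore] -/
theorem zonal_le_one_add_tail {τ s : ℝ} (hτ : 1 ≤ τ) (hs : |s| ≤ 1) : zonal τ s ≤ 1 + tail τ := by
  have hsum := summable_term hτ hs
  have hr0 : 0 ≤ Real.exp (-τ) := (Real.exp_pos _).le
  have hr1 : Real.exp (-τ) < 1 := by rw [Real.exp_lt_one_iff]; linarith
  rw [zonal, hsum.tsum_eq_zero_add]
  simp only [wt_zero, gegen_zero, mul_one]
  have hgeom : HasSum (fun k : ℕ => Real.exp (-τ) ^ (k + 1)) (tail τ) := by
    have h := (hasSum_geometric_of_lt_one hr0 hr1).mul_left (Real.exp (-τ))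
    simp only [← pow_succ'] at h
    rw [tail, div_eq_mul_inv]
    exact h
  have hbound : |∑' k : ℕ, wt (k + 1) τ * gegen (k + 1) s| ≤ tail τ := by
    have h := tsum_of_norm_bounded hgeom (fun k => by
      rw [Real.norm_eq_abs]; exact abs_term_le (k + 1) hτ hs)
    simpa [Real.norm_eq_abs] using h
  linarith [le_abs_self (∑' k : ℕ, wt (k + 1) τ * gegen (k + 1) s)]

/-- The geometric tail `t(τ) = e^{-τ}/(1 - e^{-τ})` is non-negative for `τ ≥ 0`. [folklore] -/
theorem tail_nonneg {τ : ℝ} (hτ : 0 ≤ τ) : 0 ≤ tail τ := by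
  unfold tail
  refine div_nonneg (Real.exp_pos _).le ?_
  rw [sub_nonneg, Real.exp_le_one_iff]
  linarith

/-- The geometric tail is antitone on `(0, ∞)`. [folklore] -/
theorem tail_le_tail {a b : ℝ} (ha : 0 < a) (hab : a ≤ b) : tail b ≤ tail a := by
  unfold tail
  have hea : Real.exp (-b) ≤ Real.exp (-a) := Real.exp_le_exp.2 (by linarith)
  have hda : 0 < 1 - Real.exp (-a) := by
    rw [sub_pos, Real.exp_lt_one_iff]; linarith
  exact div_le_div₀ (Real.exp_pos _).le hea hda (by linarith)

/-- The geometric tail tends to `0` at `+∞`. [folklore] -/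
theorem tendsto_tail_atTop : Filter.Tendsto tail Filter.atTop (𝓝 0) := by
  have h1 : Filter.Tendsto (fun τ : ℝ => Real.exp (-τ)) Filter.atTop (𝓝 0) :=
    Real.tendsto_exp_neg_atTop_nhds_zero
  have h := h1.div (tendsto_const_nhds.sub h1) (by norm_num : (1 : ℝ) - 0 ≠ 0)
  rw [zero_div] at h
  exact h

/-- **Pointwise large-scale upper bound of the typed kernel**: for `τ ≥ 1` and `p, z ∈ N`,
`K_{p,τ}(z) ≤ 1 + t(τ)` (zonal factor `≤ 1 + t(τ)`, Gaussian factor `≤ 1`). [folklore] -/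
theorem cylKernel_le_one_add_tail {p z : (EuclideanSpace ℝ (Fin 6))} {τ : ℝ}
    (hp : ∑ i : Fin 5, p (Fin.castSucc i) ^ 2 = 1) (hz : ∑ i : Fin 5, z (Fin.castSucc i) ^ 2 = 1)
    (hτ : 1 ≤ τ) : cylKernel p τ z ≤ 1 + tail τ := by
  rw [cylKernel_eq]
  have hS : |∑ i : Fin 5, z (Fin.castSucc i) * p (Fin.castSucc i)| ≤ 1 := abs_sum_mul_le_one hz hp
  have hzon := zonal_le_one_add_tail hτ hS
  have hg0 : 0 < Real.exp (-((z 5 - p 5) ^ 2) / (4 * τ)) := Real.exp_pos _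
  have hg1 : Real.exp (-((z 5 - p 5) ^ 2) / (4 * τ)) ≤ 1 := by
    rw [Real.exp_le_one_iff]
    exact div_nonpos_of_nonpos_of_nonneg (neg_nonpos.2 (sq_nonneg _)) (by linarith)
  have ht : 0 ≤ tail τ := tail_nonneg (by linarith)
  by_cases h0 : 0 ≤ zonal τ (∑ i : Fin 5, z (Fin.castSucc i) * p (Fin.castSucc i))
  · calc zonal τ (∑ i : Fin 5, z (Fin.castSucc i) * p (Fin.castSucc i)) *
          Real.exp (-((z 5 - p 5) ^ 2) / (4 * τ))
        ≤ zonal τ (∑ i : Fin 5, z (Fin.castSucc i) * p (Fin.castSucc i)) * 1 :=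
          mul_le_mul_of_nonneg_left hg1 h0
      _ ≤ 1 + tail τ := by rw [mul_one]; exact hzon
  · have hneg : zonal τ (∑ i : Fin 5, z (Fin.castSucc i) * p (Fin.castSucc i)) *
        Real.exp (-((z 5 - p 5) ^ 2) / (4 * τ)) ≤ 0 :=
      mul_nonpos_of_nonpos_of_nonneg (le_of_lt (not_le.1 h0)) hg0.le
    linarith

/-- **Large-scale upper bound of the typed density**: for `A ⊆ N`, `p ∈ N` and `τ ≥ 1`,
`F̂_{p,τ}(A) ≤ (1 + t(τ)) · μH⁴(A)/μH⁴(S⁴)`. [folklore] -/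
theorem cylDensity_le_one_add_tail_mul {A : Set (EuclideanSpace ℝ (Fin 6))}
    (hAN : ∀ z ∈ A, ∑ i : Fin 5, z (Fin.castSucc i) ^ 2 = 1) {p : (EuclideanSpace ℝ (Fin 6))}
    (hp : ∑ i : Fin 5, p (Fin.castSucc i) ^ 2 = 1) {τ : ℝ} (hτ : 1 ≤ τ) :
    cylDensity A p τ ≤ ENNReal.ofReal (1 + tail τ) *
      ((μH[4] (Metric.sphere (0 : (EuclideanSpace ℝ (Fin 5))) 1))⁻¹ * μH[4] A) := by
  rw [cylDensity, mul_left_comm]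
  gcongr
  rw [← setLIntegral_const]
  exact setLIntegral_mono measurable_const fun z hz =>
    ENNReal.ofReal_le_ofReal (cylKernel_le_one_add_tail hp (hAN z hz) hτ)

/-- **Registered stub `stub_relaxationOfAreaToFloor` (line `killing-flux`, crux `CylinderEntropy.CylinderRungTwo`,
stmt-SmoothPoincare4-7631; lead reshape r6): `Relaxation` FROM HAMILTON MONOTONICITY AND AREA-TO-FLOOR.**
Hypothesis 1 is the registered signature of `stub_hamiltonMonotonicity` (landed), hypothesis 2 that of
`stub_areaToFloor` (the GMT core), the conclusion is the line's `Relaxation`, all verbatim.  Given `ε`, put `δ = min(ε,1)/3`; `AreaToFloor` gives a time `t₁ ≥ T`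
with `μH⁴(M_{t₁}) ≤ (1+δ) μH⁴(S⁴)`, and `t(σ₀) < δ` for some `σ₀ ≥ 1`; for `s ≥ t₁ + σ₀` every density
`F̂_{p,τ}(M_s)` is `≤ F̂_{p,τ+s-t₁}(M_{t₁})` (Hamilton monotonicity with lag `s - t₁`)
`≤ (1 + t(τ+s-t₁)) μH⁴(M_{t₁})/μH⁴(S⁴) ≤ (1+δ)²  < 1 + ε`. [folklore] -/
theorem stub_relaxationOfAreaToFloor :
    (∀ (M : Type) [TopologicalSpace M] [T2Space M] [SecondCountableTopology M]
      [ChartedSpace (EuclideanSpace ℝ (Fin 4)) M] [IsManifold (𝓡 4) ∞ M] [CompactSpace M]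
      (F : ℝ → M → EuclideanSpace ℝ (Fin 6)) (ν : ℝ → M → EuclideanSpace ℝ (Fin 6)) (T : ℝ),
      IsCylinderMCF M F ν T →
      ∀ p : EuclideanSpace ℝ (Fin 6), ∑ i : Fin 5, p (Fin.castSucc i) ^ 2 = 1 →
      ∀ s σ τ : ℝ, T ≤ s → 0 ≤ σ → 0 < τ →
        cylDensity (Set.range (F (s + σ))) p τ ≤ cylDensity (Set.range (F s)) p (τ + σ)) →
    (∀ (M : Type) [TopologicalSpace M] [T2Space M] [SecondCountableTopology M]
      [ChartedSpace (EuclideanSpace ℝ (Fin 4)) M] [IsManifold (𝓡 4) ∞ M] [CompactSpace M]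
      [ConnectedSpace M]
      (F : ℝ → M → EuclideanSpace ℝ (Fin 6)) (ν : ℝ → M → EuclideanSpace ℝ (Fin 6)) (T : ℝ),
      IsCylinderMCF M F ν T →
      (∀ t, T ≤ t → SeparatesEnds (Set.range (F t))) →
      (∀ t, T ≤ t → cylEntropy (Set.range (F t)) < 2) →
      ∀ ε : ℝ, 0 < ε → ∃ t : ℝ, T ≤ t ∧
        μH[4] (Set.range (F t)) ≤
          ENNReal.ofReal (1 + ε) * μH[4] (Metric.sphere (0 : EuclideanSpace ℝ (Fin 5)) 1)) →
    ∀ (M : Type) [TopologicalSpace M] [T2Space M] [SecondCountableTopology M]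
      [ChartedSpace (EuclideanSpace ℝ (Fin 4)) M] [IsManifold (𝓡 4) ∞ M] [CompactSpace M]
      [ConnectedSpace M]
      (F : ℝ → M → EuclideanSpace ℝ (Fin 6)) (ν : ℝ → M → EuclideanSpace ℝ (Fin 6)) (T : ℝ),
      IsCylinderMCF M F ν T →
      (∀ t, T ≤ t → SeparatesEnds (Set.range (F t))) →
      (∀ t, T ≤ t → cylEntropy (Set.range (F t)) < 2) →
      ∀ ε : ℝ, 0 < ε → ∃ t₀ : ℝ, T ≤ t₀ ∧
        ∀ s, t₀ ≤ s → cylEntropy (Set.range (F s)) < ENNReal.ofReal (1 + ε) := by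
  intro hmono hfloor M _ _ _ _ _ _ _ F ν T hflow hsep hent ε hε
  -- the slack
  set δ : ℝ := min ε 1 / 3 with hδ
  have hδpos : 0 < δ := by rw [hδ]; exact div_pos (lt_min hε one_pos) (by norm_num)
  have hδ3 : δ ≤ 1 / 3 := by
    rw [hδ]; exact div_le_div_of_nonneg_right (min_le_right ε 1) (by norm_num)
  have hδε : 3 * δ ≤ ε := by
    rw [hδ]; linarith [min_le_left ε 1]
  -- a time where the area is within `1+δ` of the floor
  obtain ⟨t₁, hTt₁, harea⟩ := hfloor M F ν T hflow hsep hent δ hδpos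
  -- a lag beyond which the kernel tail is below `δ`
  obtain ⟨σ₀, hσ₀1, hσ₀⟩ : ∃ σ₀ : ℝ, 1 ≤ σ₀ ∧ tail σ₀ < δ :=
    ((Filter.eventually_ge_atTop 1).and
      ((tendsto_order.1 tendsto_tail_atTop).2 δ hδpos)).exists
  refine ⟨t₁ + σ₀, by linarith, fun s hs => ?_⟩
  have hvol0 : μH[4] (Metric.sphere (0 : (EuclideanSpace ℝ (Fin 5))) 1) ≠ 0 := hausdorffMeasure_sphere_four_pos.ne'
  have hvoltop : μH[4] (Metric.sphere (0 : (EuclideanSpace ℝ (Fin 5))) 1) ≠ ⊤ := hausdorffMeasure_sphere_four_lt_top.ne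
  have hratio : (μH[4] (Metric.sphere (0 : (EuclideanSpace ℝ (Fin 5))) 1))⁻¹ * μH[4] (Set.range (F t₁)) ≤
      ENNReal.ofReal (1 + δ) := by
    calc (μH[4] (Metric.sphere (0 : (EuclideanSpace ℝ (Fin 5))) 1))⁻¹ * μH[4] (Set.range (F t₁))
        ≤ (μH[4] (Metric.sphere (0 : (EuclideanSpace ℝ (Fin 5))) 1))⁻¹ *
            (ENNReal.ofReal (1 + δ) * μH[4] (Metric.sphere (0 : (EuclideanSpace ℝ (Fin 5))) 1)) := by gcongr
      _ = ENNReal.ofReal (1 + δ) := by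
          rw [mul_comm (ENNReal.ofReal _), ← mul_assoc, ENNReal.inv_mul_cancel hvol0 hvoltop, one_mul]
  have hbound : ∀ p : (EuclideanSpace ℝ (Fin 6)), ∑ i : Fin 5, p (Fin.castSucc i) ^ 2 = 1 → ∀ τ : ℝ, 0 < τ →
      cylDensity (Set.range (F s)) p τ ≤ ENNReal.ofReal ((1 + δ) * (1 + δ)) := by
    intro p hp τ hτ
    have hσ : 0 ≤ s - t₁ := by linarith
    have h1 := hmono M F ν T hflow p hp t₁ (s - t₁) τ hTt₁ hσ hτ
    rw [show t₁ + (s - t₁) = s by ring] at h1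
    have hτ' : 1 ≤ τ + (s - t₁) := by linarith
    have h2 := cylDensity_le_one_add_tail_mul (A := Set.range (F t₁))
      (by rintro z ⟨x, rfl⟩; exact hflow.mem_cyl t₁ hTt₁ x) hp hτ'
    have h3 : tail (τ + (s - t₁)) ≤ δ :=
      ((tail_le_tail (by linarith) (by linarith : σ₀ ≤ τ + (s - t₁))).trans hσ₀.le)
    calc cylDensity (Set.range (F s)) p τ
        ≤ cylDensity (Set.range (F t₁)) p (τ + (s - t₁)) := h1
      _ ≤ ENNReal.ofReal (1 + tail (τ + (s - t₁))) *
            ((μH[4] (Metric.sphere (0 : (EuclideanSpace ℝ (Fin 5))) 1))⁻¹ * μH[4] (Set.range (F t₁))) := h2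
      _ ≤ ENNReal.ofReal (1 + δ) * ENNReal.ofReal (1 + δ) := by
          gcongr
      _ = ENNReal.ofReal ((1 + δ) * (1 + δ)) := (ENNReal.ofReal_mul (by linarith)).symm
  have hle : cylEntropy (Set.range (F s)) ≤ ENNReal.ofReal ((1 + δ) * (1 + δ)) := by
    simp only [cylEntropy]
    exact iSup₂_le fun p hp => iSup₂_le fun τ hτ => hbound p hp τ hτ
  refine lt_of_le_of_lt hle ?_
  rw [ENNReal.ofReal_lt_ofReal_iff (by linarith)]
  nlinarith

end Summit.SmoothPoincare4.SmoothPoincare4.Cruxes.CylinderRungTwo.KillingFlux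

end
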